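import Literature.AnabelianGeometry.EtaleTheta.GalSectThm110iiiEndKnitXTor
import Literature.AnabelianGeometry.EtaleTheta.GalSectDeltaXTransport
import Literature.AnabelianGeometry.EtaleTheta.GalSectDotCSameField
import Literature.AnabelianGeometry.EtaleTheta.GalSectPreservedByImage
import HarnessLib

/-!
# [EtTh] Thm. 1.10 (iii) after the 13:00Z v-next of `MuTwoSetting.DotCCusp` (G-w5d062-2, census C7): the END-KNIT
# with the law / topological clauses / commensurable terminality as FIELDS, and the re-typed `Thm110iiiEta` CLOSED
# from named inputs (proof-only)

Mochizuki, *The étale theta function …* [EtTh], Publ. RIMS **45** (2009), Thm. 1.10 (iii) p.256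
[cite: MochizukiEtTh2009, Thm 1.10 (iii) p.30]; [GalSect] §4 / Def. 4.1 [cite: MochizukiGalSect2005, §4 p.33].
abc-iut cell, layer L2, seat abc-iut-w5-d062 lineage; sequel of p435878 / p438817 to be filed AFTER the v-next texts
(vnext/v3) of `GalSectThm110iii.lean` are accepted and built.  PROOF-ONLY: no definitions, no named facts.

* `DotCCusp.isCompact_I` / `isMulCommutative_I` — from the v-next field `inertia_equiv_zHat`;
* `thm110iiiGalSect_of_genuineTorsor_v2` — p435878's closer with `hcan` and the topological side binders now FIELDS;
* `thm110iiiEta_of_namedInputs` — the re-typed (NOT `∃`-shaped) statement from (b1) + (compat) + (funct);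
  `thm110iiiGalSect_of_eta`; `Thm110iiiEta.exists_etaStructure_eq_image` (consumption discipline).
HONEST FRAMING: named inputs are printed inferences / cited results, none asserted; typed ≠ proved; no side taken
on [IUTchIII] Cor. 3.12.
-/

namespace Literature.AnabelianGeometry.EtaleTheta

open scoped Pointwise

open Literature.AnabelianGeometry.SemiGraphs

namespace MuTwoSetting.DotCCusp

variable {p : ℕ} [Fact p.Prime] {M : MuTwoSetting p} {εZ : M.GtpC} (C : M.DotCCusp εZ)

/-- v2 field `inertia_equiv_zHat` ⇒ the inertia at the cusp of `Ċ` is COMPACT. [cite: MochizukiGalSect2005, §4 p.33] -/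
theorem isCompact_I : IsCompact (C.pair.I : Set M.GtpC) := by
  obtain ⟨e⟩ := C.inertia_equiv_zHat
  haveI : CompactSpace C.pair.I := e.toHomeomorph.symm.compactSpace
  exact isCompact_iff_compactSpace.mpr inferInstance

/-- v2 field `inertia_equiv_zHat` ⇒ the inertia at the cusp of `Ċ` is ABELIAN. [cite: MochizukiGalSect2005, §4 p.33] -/
theorem isMulCommutative_I : IsMulCommutative C.pair.I := by
  obtain ⟨e⟩ := C.inertia_equiv_zHat
  exact ⟨⟨Literature.AnabelianGeometry.AbsoluteAnabelian.ZHatCompletion.mul_comm_of_mulEquiv e.toMulEquiv⟩⟩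

end MuTwoSetting.DotCCusp

section EndKnitV2

variable {p : ℕ} [Fact p.Prime] {Mα Mβ : MuTwoSetting p} {εα : Mα.GtpC} {εβ : Mβ.GtpC}
  {hCα : Mα.toThetaSetting.Compat} {hCβ : Mβ.toThetaSetting.Compat}
  {Eα : Mα.toThetaSetting.EtaleThetaData} {Eβ : Mβ.toThetaSetting.EtaleThetaData}
  {γ : Mα.dotC εα ≃ₜ* Mβ.dotC εβ}

/-- **v2 of `thm110iiiGalSect_of_genuineTorsor`**: the law binder `hcan` is now the field
`DotCCusp.canonical_isStructure`, and the topological side conditions (`D` closed, `I` compact abelian) come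
from the fields `isClosed_D` / `inertia_equiv_zHat` (v-next G-w5d062-2) — only `Π^tp_C` T1 stays a side
condition. [cite: MochizukiEtTh2009, Thm 1.10 (iii) p.30] -/
theorem thm110iiiGalSect_of_genuineTorsor_v2 [T1Space Mα.GtpC] [T1Space Mβ.GtpC]
    (H : Thm110Hypothesis εα εβ hCα hCβ Eα Eβ γ)
    (Sα : Mα.StandardData Eα.toKummerData) (Sβ : Mβ.StandardData Eβ.toKummerData)
    (Cα : Mα.DotCCusp εα) (Cβ : Mβ.DotCCusp εβ)
    {c : Mβ.GtpC} (hc : c ∈ Mβ.dotC εβ)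
    (hpair : Cα.pair.map (H.Γ.trans (Mβ.innerAutC c)) = Cβ.pair)
    {S₀α : Subgroup Mα.GtpC} (hS₀α : S₀α ∈ Cα.pair.splittings)
    {S₀β : Subgroup Mβ.GtpC} (hS₀β : S₀β ∈ Cβ.pair.splittings)
    (hgenα : haveI := Cα.isMulCommutative_I
      haveI := Cα.pair.ID_normal
      ∃ κ : GalSect.KxHat Mα.toThetaSetting.toTemperedCurve ≃*
          ↥(ContH1.resKer Cα.pair.ID (⊤ : Subgroup Cα.pair.D)
            (Cα.pair.isClosedComplement_of_mem_splittings hS₀α).le_left),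
        ∀ k cl, Cα.torsor.act k cl = (Cα.pair.torsorDataH1 Cα.isClosed_D Cα.isCompact_I hS₀α).act (κ k) cl)
    (hgenβ : haveI := Cβ.isMulCommutative_I
      haveI := Cβ.pair.ID_normal
      ∃ κ : GalSect.KxHat Mβ.toThetaSetting.toTemperedCurve ≃*
          ↥(ContH1.resKer Cβ.pair.ID (⊤ : Subgroup Cβ.pair.D)
            (Cβ.pair.isClosedComplement_of_mem_splittings hS₀β).le_left),
        ∀ k cl, Cβ.torsor.act k cl = (Cβ.pair.torsorDataH1 Cβ.isClosed_D Cβ.isCompact_I hS₀β).act (κ k) cl)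
    (hμ : ∀ (δ : GalSect.KxHat Mα.toThetaSetting.toTemperedCurve →* GalSect.KxHat Mβ.toThetaSetting.toTemperedCurve)
        (e : Cα.pair.SplittingClass → Cβ.pair.SplittingClass),
      (∀ (S : Subgroup Mα.GtpC) (hS : S ∈ Cα.pair.splittings),
        ∃ h', e (GalSect.CuspPair.SplittingClass.mk Cα.pair S hS) =
          GalSect.CuspPair.SplittingClass.mk Cβ.pair
            (S.map (H.Γ.trans (Mβ.innerAutC c)).toMulEquiv.toMonoidHom) h') →
      (∀ (k : GalSect.KxHat Mα.toThetaSetting.toTemperedCurve) (cl : Cα.pair.SplittingClass),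
        e (Cα.torsor.act k cl) = Cβ.torsor.act (δ k) (e cl)) →
      Mα.muTwoHat.map δ = Mβ.muTwoHat)
    (hecan : ∀ (e : Cα.pair.SplittingClass → Cβ.pair.SplittingClass),
      (∀ (S : Subgroup Mα.GtpC) (hS : S ∈ Cα.pair.splittings),
        ∃ h', e (GalSect.CuspPair.SplittingClass.mk Cα.pair S hS) =
          GalSect.CuspPair.SplittingClass.mk Cβ.pair
            (S.map (H.Γ.trans (Mβ.innerAutC c)).toMulEquiv.toMonoidHom) h') →
      e '' Cα.canonical ⊆ Cβ.canonical) :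
    Thm110iiiGalSect H Sα Sβ Cα Cβ :=
  haveI := Cα.isMulCommutative_I
  haveI := Cβ.isMulCommutative_I
  thm110iiiGalSect_of_genuineTorsor H Sα Sβ Cα Cβ Cα.isClosed_D Cα.isCompact_I Cβ.isClosed_D Cβ.isCompact_I
    Cα.canonical_isStructure hc hpair hS₀α hS₀β hgenα hgenβ hμ hecan

/-- **v2 of the ONE closer with the fully X-level residual** (`thm110iiiGalSect_of_Xlevel_twoTorsion`,
abc-iut-w5-d062): the law is the field `canonical_isStructure`, the side conditions come from `isClosed_D` /
`inertia_equiv_zHat`; (ΔX) enters BY NAME as [AbsAnab] Lem. 1.3.8 (F-0007 `PreservesGeom` at the completed `γ̂_X`,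
`GalSectDeltaXTransport`) and (nX) as (sf) «`Ċ` over `K`» (`GalSectDotCSameField`); residual = (x), (ct) ×2,
F-0007, (sf) ×2, (tf), (gen) ×2, (μtor) ×2, (b3) — and `Π^tp_C` T1.
[cite: MochizukiEtTh2009, Thm 1.10 (iii) p.30] -/
theorem thm110iiiGalSect_of_Xlevel_v2 [T1Space Mα.GtpC] [T1Space Mβ.GtpC]
    (H : Thm110Hypothesis εα εβ hCα hCβ Eα Eβ γ)
    (Sα : Mα.StandardData Eα.toKummerData) (Sβ : Mβ.StandardData Eβ.toKummerData)
    (Cα : Mα.DotCCusp εα) (Cβ : Mβ.DotCCusp εβ)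
    -- (x) + (ct)
    {σ : Mβ.PiTemp} (hσ : Mβ.inclX σ ∈ Mβ.dotC εβ)
    (hX : (MulAut.conj Cα.conj • Mα.decomp Cα.cusp).map H.γX.toMulEquiv.toMonoidHom =
      MulAut.conj σ • (MulAut.conj Cβ.conj • Mβ.decomp Cβ.cusp))
    (hCTα : ∀ g ∈ Mα.dotC εα, Subgroup.Commensurable (MulAut.conj g • Cα.pair.D) Cα.pair.D → g ∈ Cα.pair.D)
    (hCTβ : ∀ g ∈ Mβ.dotC εβ, Subgroup.Commensurable (MulAut.conj g • Cβ.pair.D) Cβ.pair.D → g ∈ Cβ.pair.D)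
    -- (tf) no `2`-torsion in the image of `G_K`
    -- (ΔX) BY NAME: [AbsAnab] Lem. 1.3.8 = FACT F-0007 `PreservesGeom` at fundamental extensions modelling
    -- `Π_{Xα} ↠ G_{Kα}`, `Π_{Xβ} ↠ G_{Kβ}` and the completed isomorphism `γ̂_X` (`GalSectDeltaXTransport`)
    (Eα Eβ : Literature.AnabelianGeometry.AbsoluteAnabelian.FundamentalExtension.{0})
    (eα : Eα.arith ≃ₜ* Mα.PiHat) (eβ : Eβ.arith ≃ₜ* Mβ.PiHat)
    (heα : Eα.geom.map eα.toMulEquiv.toMonoidHom = Mα.DeltaHat)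
    (heβ : Eβ.geom.map eβ.toMulEquiv.toMonoidHom = Mβ.DeltaHat)
    (h138 : ∀ Φ : Mα.PiHat ≃ₜ* Mβ.PiHat, (∀ x : Mα.PiTemp, Φ (Mα.toHat x) = Mβ.toHat (H.γX x)) →
      Literature.AnabelianGeometry.AbsoluteAnabelian.FundamentalExtension.PreservesGeom (F := Eβ)
        (eα.trans (Φ.trans eβ.symm)))
    -- (sf) «`Ċ` is defined over `K`»: `augC(Π^tp_C) ⊆ aug(Π^tp_X)` (`GalSectDotCSameField`), at `α` and `β`
    (hsfα : ∀ g : Mα.GtpC, ∃ h : Mα.PiTemp, Cα.augC g = Mα.aug h)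
    (hsfβ : ∀ g : Mβ.GtpC, ∃ h : Mβ.PiTemp, Cβ.augC g = Mβ.aug h)
    (htf : ∀ x : Mβ.PiTemp, Mβ.aug x * Mβ.aug x = 1 → Mβ.aug x = 1)
    -- (gen)
    {S₀α : Subgroup Mα.GtpC} (hS₀α : S₀α ∈ Cα.pair.splittings)
    {S₀β : Subgroup Mβ.GtpC} (hS₀β : S₀β ∈ Cβ.pair.splittings)
    (hgenα : haveI := Cα.isMulCommutative_I
      haveI := Cα.pair.ID_normal
      ∃ κ : GalSect.KxHat Mα.toThetaSetting.toTemperedCurve ≃*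
          ↥(ContH1.resKer Cα.pair.ID (⊤ : Subgroup Cα.pair.D)
            (Cα.pair.isClosedComplement_of_mem_splittings hS₀α).le_left),
        ∀ k cl, Cα.torsor.act k cl = (Cα.pair.torsorDataH1 Cα.isClosed_D Cα.isCompact_I hS₀α).act (κ k) cl)
    (hgenβ : haveI := Cβ.isMulCommutative_I
      haveI := Cβ.pair.ID_normal
      ∃ κ : GalSect.KxHat Mβ.toThetaSetting.toTemperedCurve ≃*
          ↥(ContH1.resKer Cβ.pair.ID (⊤ : Subgroup Cβ.pair.D)
            (Cβ.pair.isClosedComplement_of_mem_splittings hS₀β).le_left),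
        ∀ k cl, Cβ.torsor.act k cl = (Cβ.pair.torsorDataH1 Cβ.isClosed_D Cβ.isCompact_I hS₀β).act (κ k) cl)
    -- (μtor) ×2
    (htorα : ∀ x : GalSect.KxHat Mα.toThetaSetting.toTemperedCurve, x * x = 1 → x ∈ Mα.muTwoHat)
    (htorβ : ∀ x : GalSect.KxHat Mβ.toThetaSetting.toTemperedCurve, x * x = 1 → x ∈ Mβ.muTwoHat)
    (hecan : ∀ c ∈ Mβ.dotC εβ, ∀ (e : Cα.pair.SplittingClass → Cβ.pair.SplittingClass),
      (∀ (S : Subgroup Mα.GtpC) (hS : S ∈ Cα.pair.splittings),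
        ∃ h', e (GalSect.CuspPair.SplittingClass.mk Cα.pair S hS) =
          GalSect.CuspPair.SplittingClass.mk Cβ.pair
            (S.map (H.Γ.trans (Mβ.innerAutC c)).toMulEquiv.toMonoidHom) h') →
      e '' Cα.canonical ⊆ Cβ.canonical) :
    Thm110iiiGalSect H Sα Sβ Cα Cβ :=
  haveI := Cα.isMulCommutative_I
  haveI := Cβ.isMulCommutative_I
  thm110iiiGalSect_of_Xlevel_twoTorsion H Sα Sβ Cα Cβ Cα.isClosed_D Cα.isCompact_I Cβ.isClosed_D Cβ.isCompact_I
    Cα.canonical_isStructure hσ hX hCTα hCTβ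
    (Mα.toThetaSetting.map_ker_aug_eq_of_forall_preservesGeom Mβ.toThetaSetting H.γX Eα Eβ eα eβ heα heβ
      h138)
    (Cα.not_ker_augC_le_range_of_sameField hsfα) (Cβ.not_ker_augC_le_range_of_sameField hsfβ) htf hS₀α hS₀β
    hgenα hgenβ htorα htorβ hecan

/-- **[EtTh] Thm. 1.10 (iii), re-typed (`Thm110iiiEta`, NOT `∃`-shaped) — CLOSED from NAMED inputs**:
(b1) the cusp-pair transport; (compat) the `η̈^{Θ,Z}`-determined `{±1}`-structures lie in the canonical integral
structures ("compatible with the canonical integral structure": standard type ⇒ unit leading term); (funct) THE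
class transport along `Γ ∘ Inn(c)` carries the `η̈`-determined structure of `Ċα` onto that of `Ċβ`
("`γ` maps `η̈α ↦ η̈β`" + functoriality of the leading term = the (i)/(ii) junction).  No torsor bookkeeping
remains: "preserved by `γ`" is `preservedBy_image_classTransport` (p433009).  The premises `Odd p` / standard
type are carried, not used — they are the hypotheses under which print asserts (compat)/(funct).
[cite: MochizukiEtTh2009, Thm 1.10 (iii) p.30] -/
theorem thm110iiiEta_of_namedInputs (H : Thm110Hypothesis εα εβ hCα hCβ Eα Eβ γ)
    (Sα : Mα.StandardData Eα.toKummerData) (Sβ : Mβ.StandardData Eβ.toKummerData)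
    (Cα : Mα.DotCCusp εα) (Cβ : Mβ.DotCCusp εβ)
    -- (b1)
    {c : Mβ.GtpC} (hc : c ∈ Mβ.dotC εβ)
    (hpair : Cα.pair.map (H.Γ.trans (Mβ.innerAutC c)) = Cβ.pair)
    -- (compat)
    (hcompatα : Cα.etaStructure ⊆ Cα.canonical) (hcompatβ : Cβ.etaStructure ⊆ Cβ.canonical)
    -- (funct)
    (hfunct : ∀ (e : Cα.pair.SplittingClass → Cβ.pair.SplittingClass),
      (∀ (S : Subgroup Mα.GtpC) (hS : S ∈ Cα.pair.splittings),
        ∃ h', e (GalSect.CuspPair.SplittingClass.mk Cα.pair S hS) =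
          GalSect.CuspPair.SplittingClass.mk Cβ.pair
            (S.map (H.Γ.trans (Mβ.innerAutC c)).toMulEquiv.toMonoidHom) h') →
      e '' Cα.etaStructure = Cβ.etaStructure) :
    Thm110iiiEta H Sα Sβ Cα Cβ := by
  intro _ _ _
  obtain ⟨e, he⟩ := GalSect.CuspPair.exists_classTransport (H.Γ.trans (Mβ.innerAutC c)) hpair
  refine ⟨hcompatα, hcompatβ, c, hc, ?_⟩
  have key := GalSect.CuspPair.preservedBy_image_classTransport hpair he Cα.etaStructure
  rwa [hfunct e he] at key

/-- **The re-typed (iii) is INHABITED — the identity case.**  At `α = β`, for a hypothesis structure whose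
extension `Γ` is the identity and any cusp datum satisfying the (compat) clause (`η̈`-determined structure inside
the canonical integral structure), `Thm110iiiEta` HOLDS with `c = 1`: the class transport along the identity is
the identity, so (funct) is `id '' _ = _`.  The analogue of O1's `thm110iiiGalSect_of_refl` for the v-next
statement (statement-strength evidence; no theta input is used). [cite: MochizukiEtTh2009, Thm 1.10 (iii) p.30] -/
theorem thm110iiiEta_of_refl {M : MuTwoSetting p} {εZ : M.GtpC} {hC : M.toThetaSetting.Compat}
    {E : M.toThetaSetting.EtaleThetaData}
    (H : Thm110Hypothesis εZ εZ hC hC E E (ContinuousMulEquiv.refl (M.dotC εZ)))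
    (hΓ : H.Γ = ContinuousMulEquiv.refl M.GtpC) (S : M.StandardData E.toKummerData) (C : M.DotCCusp εZ)
    (hcompat : C.etaStructure ⊆ C.canonical) :
    Thm110iiiEta H S S C C := by
  have hid : ∀ x, (H.Γ.trans (M.innerAutC 1)) x = x := by
    intro x
    rw [hΓ]
    change 1 * x * 1⁻¹ = x
    simp
  have hmap : ∀ S' : Subgroup M.GtpC,
      S'.map (H.Γ.trans (M.innerAutC 1)).toMulEquiv.toMonoidHom = S' := by
    intro S'
    ext x
    constructor
    · rintro ⟨y, hy, rfl⟩
      change (H.Γ.trans (M.innerAutC 1)) y ∈ S'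
      rw [hid]
      exact hy
    · intro hx
      exact ⟨x, hx, hid x⟩
  refine thm110iiiEta_of_namedInputs H S S C C (M.dotC εZ).one_mem
    (GalSect.CuspPair.ext' (hmap _) (hmap _)) hcompat hcompat ?_
  intro e he
  -- the class transport along the identity is the identity
  have heid : e = id := by
    funext c
    obtain ⟨S', hS', rfl⟩ := GalSect.CuspPair.SplittingClass.exists_rep C.pair c
    obtain ⟨h', he'⟩ := he S' hS'
    rw [he']
    exact (GalSect.CuspPair.SplittingClass.mk_eq_mk_iff h' hS').2
      ⟨1, C.pair.I.one_mem, by rw [map_one, one_smul, hmap]⟩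
  rw [heid, Set.image_id]

/-- Hence, with the identity witness of `Thm110Hypothesis` (`Thm110HypothesisRefl.lean`): for every
`MuTwoSetting`, admissible `ε_Z`, `Compat`, étale theta datum, standard data and cusp datum satisfying (compat),
SOME hypothesis structure over the identity `γ` satisfies the re-typed Thm. 1.10 (iii) — an UNCONDITIONAL
inhabited instance of `Thm110iiiEta`. [cite: MochizukiEtTh2009, Thm 1.10 (iii) p.30] -/
theorem exists_thm110iiiEta_refl (M : MuTwoSetting p) {εZ : M.GtpC} (hZ : M.IsAdmissibleEpsZ εZ)
    (hC : M.toThetaSetting.Compat) (E : M.toThetaSetting.EtaleThetaData)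
    (S : M.StandardData E.toKummerData) (C : M.DotCCusp εZ) (hcompat : C.etaStructure ⊆ C.canonical) :
    ∃ H : Thm110Hypothesis εZ εZ hC hC E E (ContinuousMulEquiv.refl (M.dotC εZ)),
      Thm110iiiEta H S S C C :=
  ⟨{ admα := hZ
     admβ := hZ
     Γ := ContinuousMulEquiv.refl M.GtpC
     preserves := M.preservesCoverings_refl εZ
     restricts := ⟨1, fun x => by rw [inv_one, mul_one, one_mul]; rfl⟩
     γX := ContinuousMulEquiv.refl M.PiTemp
     γX_spec := fun _ => rfl
     thm16i := ThetaSetting.thm16i_refl M.toThetaSetting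
     companion := ThetaSetting.ThetaCompanion.ofRefl M.toThetaSetting
     maps_orbit := fun y => by
       constructor
       · intro hy
         exact ⟨y, hy, (ThetaSetting.transport_refl _ _ y).symm⟩
       · rintro ⟨x, hx, rfl⟩
         rw [ThetaSetting.transport_refl]
         exact hx },
    thm110iiiEta_of_refl _ rfl S C hcompat⟩

/-- … and the re-typed statement implies the v1 `∃`-shaped one (so every consumer of `Thm110iiiGalSect` is
served by the `η̈`-determined structures). [cite: MochizukiEtTh2009, Thm 1.10 (iii) p.30] -/
theorem thm110iiiGalSect_of_eta (H : Thm110Hypothesis εα εβ hCα hCβ Eα Eβ γ)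
    (Sα : Mα.StandardData Eα.toKummerData) (Sβ : Mβ.StandardData Eβ.toKummerData)
    (Cα : Mα.DotCCusp εα) (Cβ : Mβ.DotCCusp εβ) (h : Thm110iiiEta H Sα Sβ Cα Cβ) :
    Thm110iiiGalSect H Sα Sβ Cα Cβ := by
  intro hp hα hβ
  obtain ⟨hcα, hcβ, c, hc, hpres⟩ := h hp hα hβ
  exact ⟨Cα.etaStructure, Cβ.etaStructure, ⟨Cα.etaStructure_isStructure, hcα⟩,
    ⟨Cβ.etaStructure_isStructure, hcβ⟩, c, hc, hpres⟩

/-- **Consequence / consumption discipline**: when the re-typed (iii) fires, the `η̈`-determined structure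
of `Ċβ` IS the transport of that of `Ċα` along `Γ ∘ Inn c` for the produced `c` (for ANY map `e` that is
`S ↦ Γ S` on classes) — so `Thm110iiiEta` must be consumed at cusp data whose `etaStructure` fields are the
GENUINE `η̈`-determined orbits (an origin clause); replacing `Cβ.etaStructure` by another `μ₂`-orbit falsifies
it (the `∀`-closure over the free datum is not print's claim, cf. audit F-w5d016-g3-1 for `canonical`).
[cite: MochizukiEtTh2009, Thm 1.10 (iii) p.30] -/
theorem Thm110iiiEta.exists_etaStructure_eq_image {H : Thm110Hypothesis εα εβ hCα hCβ Eα Eβ γ}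
    {Sα : Mα.StandardData Eα.toKummerData} {Sβ : Mβ.StandardData Eβ.toKummerData}
    {Cα : Mα.DotCCusp εα} {Cβ : Mβ.DotCCusp εβ} (h : Thm110iiiEta H Sα Sβ Cα Cβ) (hp : Odd p)
    (hα : Mα.IsOfStandardType hCα εα Sα Eα.etaDd) (hβ : Mβ.IsOfStandardType hCβ εβ Sβ Eβ.etaDd) :
    ∃ c ∈ Mβ.dotC εβ, ∀ (e : Cα.pair.SplittingClass → Cβ.pair.SplittingClass),
      (∀ (S : Subgroup Mα.GtpC) (hS : S ∈ Cα.pair.splittings),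
        ∃ h', e (GalSect.CuspPair.SplittingClass.mk Cα.pair S hS) =
          GalSect.CuspPair.SplittingClass.mk Cβ.pair
            (S.map (H.Γ.trans (Mβ.innerAutC c)).toMulEquiv.toMonoidHom) h') →
      Cβ.etaStructure = e '' Cα.etaStructure := by
  obtain ⟨-, -, c, hc, hpres⟩ := h hp hα hβ
  exact ⟨c, hc, fun e he => hpres.eq_image he⟩  -- `PreservedBy.eq_image`: GalSectPreservedByImage.lean

end EndKnitV2

end Literature.AnabelianGeometry.EtaleTheta

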